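import Mathlib
import Literature.Computability.AlgebraicComplexity.NewtonPolygonTau
import Summits.ValiantsHypothesis.ValiantsHypothesis.Theses.NewtonUnitEquations

/-!
# Sketch — crux NewtonTauWeak (stmt-ValiantsHypothesis-5904), ideator 2, round 1

First-lemma signatures for the two crux idea cards filed this round:

* card `euler-wronskian-vdp`: `PowersFixedK` (the unconditional m-free rung the lever proves),
  `PowersPoly` (the transfer target C⁺), `PowersTauWeak` (Fischer-equivalent form of the crux) and
  the direction `PowersTauWeak → NewtonTauWeak` the line must formalise (tree: `fischer_ryser`).
* card `exp-divided-differences`: `TransversalCount` (corner atlas: no shared corners ⇒ ≤ (k+1)kmt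
  edges — the KPR Lemma 1.16 analogue over ℂ), `TwoProductsPencil` (TwoProducts uniform in the
  pencil parameter) and the k = 3 step `TwoProductsPencil → ThreeProducts`.

Nothing is proved here; every `def` is a `Prop` that elaborates over existing declarations
(`Literature.Computability.AlgebraicComplexity.newtonVertexCount`,
`Summit.ValiantsHypothesis.ValiantsHypothesis.Theses.NewtonUnitEquations.NewtonTauWeak`).
-/

noncomputable section

open scoped BigOperators Pointwise

namespace Summit.ValiantsHypothesis.ValiantsHypothesis.Cruxes.NewtonTauWeak.IdeatorTwo

open Literature.Computability.AlgebraicComplexity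

/-- Embedding of exponent vectors into `ℝ²` (as in the crux). -/
def ι (e : Fin 2 →₀ ℕ) : Fin 2 → ℝ := fun l => ((e l : ℕ) : ℝ)

/-- Vertex SET of the Newton polygon of a bivariate polynomial. -/
def vertexSet (p : MvPolynomial (Fin 2) ℂ) : Set (Fin 2 → ℝ) :=
  Set.extremePoints ℝ (convexHull ℝ (ι '' (p.support : Set (Fin 2 →₀ ℕ))))

/-! ### Card A (`euler-wronskian-vdp`) -/

/-- KPTT Thm 3 form of the crux: sums of `k` `m`-th powers of `t`-nomials (Fischer-equivalent to
`NewtonTauWeak`, same shape of bound). -/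
def PowersTauWeak : Prop :=
  ∃ a b : ℕ, ∀ (k m t : ℕ) (c : Fin k → ℂ) (f : Fin k → MvPolynomial (Fin 2) ℂ),
    (∀ i, (f i).support.card ≤ t) →
      newtonVertexCount (∑ i, MvPolynomial.C (c i) * f i ^ m) ≤ 2 ^ (a * m) * (k * t + 2) ^ b

/-- Transfer target C⁺ of card A: an `m`-FREE polynomial bound for the powers form. It implies
`PowersTauWeak`, hence the crux. -/
def PowersPoly : Prop :=
  ∃ b : ℕ, ∀ (k m t : ℕ) (c : Fin k → ℂ) (f : Fin k → MvPolynomial (Fin 2) ℂ),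
    (∀ i, (f i).support.card ≤ t) →
      newtonVertexCount (∑ i, MvPolynomial.C (c i) * f i ^ m) ≤ (k * t + 2) ^ b

/-- FIRST LEMMA of card A (the rung the ultrametric Voorhoeve–van der Poorten lemma proves, with
`C = O(k²)`): for each fixed number `k` of powers the vertex count is bounded independently of the
exponent `m`, coincidences allowed. -/
def PowersFixedK : Prop :=
  ∀ k : ℕ, ∃ C : ℕ, ∀ (m t : ℕ) (c : Fin k → ℂ) (f : Fin k → MvPolynomial (Fin 2) ℂ),
    (∀ i, (f i).support.card ≤ t) →
      newtonVertexCount (∑ i, MvPolynomial.C (c i) * f i ^ m) ≤ (t + 2) ^ C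

/-- The `k = 2` instance, with the explicit bound the corner argument gives (`O(t²)`). -/
def PowersTwoTerms : Prop :=
  ∃ C : ℕ, ∀ (m t : ℕ) (a b : ℂ) (f g : MvPolynomial (Fin 2) ℂ),
    f.support.card ≤ t → g.support.card ≤ t →
      newtonVertexCount (MvPolynomial.C a * f ^ m + MvPolynomial.C b * g ^ m) ≤ C * (t + 2) ^ 2

/-- The Fischer direction the line formalises first (tree: `fischer_ryser`). -/
def FischerStep : Prop :=
  PowersTauWeak → Summit.ValiantsHypothesis.ValiantsHypothesis.Theses.NewtonUnitEquations.NewtonTauWeak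

/-- and the trivial chain of strengthenings. -/
def PowersChain : Prop :=
  (PowersPoly → PowersTauWeak) ∧ (PowersTauWeak → PowersFixedK → True)

/-! ### Card B (`exp-divided-differences`) -/

/-- FIRST LEMMA of card B (corner atlas, KPR Lemma 1.16 over `ℂ`): if no two of the `k` honest
corner maps ever share a `w`-minimal point (the Minkowski sums of the supports have pairwise
distinct `w`-minimisers for every nonzero functional `w`), there is no cancelling corner and the
Newton polygon has at most `(k+1)·kmt + 2` vertices. -/
def TransversalCount : Prop :=
  ∀ (k m t : ℕ) (f : Fin k → Fin m → MvPolynomial (Fin 2) ℂ),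
    (∀ i j, (f i j).support.card ≤ t) →
    (∀ i i' : Fin k, i ≠ i' → ∀ w : Fin 2 → ℝ, w ≠ 0 →
      ∀ x ∈ (∑ j, (f i j).support : Finset (Fin 2 →₀ ℕ)),
      ∀ y ∈ (∑ j, (f i' j).support : Finset (Fin 2 →₀ ℕ)),
        (∀ x' ∈ (∑ j, (f i j).support : Finset (Fin 2 →₀ ℕ)), ∑ l, w l * ι x l ≤ ∑ l, w l * ι x' l) →
        (∀ y' ∈ (∑ j, (f i' j).support : Finset (Fin 2 →₀ ℕ)), ∑ l, w l * ι y l ≤ ∑ l, w l * ι y' l) →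
          x ≠ y) →
      newtonVertexCount (∑ i, ∏ j, f i j) ≤ (k + 1) * (k * m * t) + 2

/-- TwoProducts uniform in the pencil parameter: the set of points that are vertices of
`Newt(∏ f - c ∏ g)` for SOME `c ∈ ℂ` is small (what every λ-free corner method actually bounds;
it is `≤ 2mt ×` TwoProducts). -/
def TwoProductsPencil : Prop :=
  ∃ a b : ℕ, ∀ (m t : ℕ) (f g : Fin m → MvPolynomial (Fin 2) ℂ),
    (∀ j, (f j).support.card ≤ t) → (∀ j, (g j).support.card ≤ t) →
      (⋃ c : ℂ, vertexSet (∏ j, f j - MvPolynomial.C c * ∏ j, g j)).ncard ≤ 2 ^ (a * m) * (t + 2) ^ b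

/-- The crux at `k = 3`. -/
def ThreeProducts : Prop :=
  ∃ a b : ℕ, ∀ (m t : ℕ) (f : Fin 3 → Fin m → MvPolynomial (Fin 2) ℂ),
    (∀ i j, (f i j).support.card ≤ t) →
      newtonVertexCount (∑ i, ∏ j, f i j) ≤ 2 ^ (a * m) * (t + 2) ^ b

/-- The first reduction step card B claims (k = 3 from the pairwise log-ratio objects, via the
unit divided differences of `exp` and the tie analysis). -/
def StepThree : Prop := TwoProductsPencil → ThreeProducts

/-- Sanity: the crux decl is the shared target of both routes. -/
example : Summit.ValiantsHypothesis.ValiantsHypothesis.Theses.NewtonUnitEquations.NewtonTauWeak ↔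
    KPTT.newtonTauWeak := Iff.rfl

end Summit.ValiantsHypothesis.ValiantsHypothesis.Cruxes.NewtonTauWeak.IdeatorTwo

end
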